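import Literature.Analysis.FluidPDE.KatoLocalHolds
import Literature.Analysis.FluidPDE.HeatFlowGigaL5
import Literature.Analysis.FluidPDE.VolterraQuarterKernel
import Literature.Analysis.FluidPDE.LerayHopfProofs
import Literature.Analysis.FluidPDE.NSLerayHopfABCScaling
import Literature.Analysis.FluidPDE.KatoMaximalTime
import Literature.Analysis.FunctionSpaces.TimeMollification
import HarnessLib

/-!
# Kato's `L³` solution lies in `L⁵(0, T; L⁵)`: the `L₅(Q_T)` clause of ESS 2003, Thm. 7.4

Analysis/FluidPDE proof file (theorems only, everything proved) on the discharge path of the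
named fact `Literature.Analysis.FluidPDE.ess_kato_L3_local` (`NSLerayHopfProofs.lean`;
Escauriaza–Seregin–Šverák 2003, Thm. 7.4 with Remark 7.5: for `a ∈ L₃ ∩ J̊` Kato's local
solution satisfies (7.31) `u ∈ C([0,T⋆]; L₃) ∩ L₅(Q_{T⋆}) ∩ L₄(Q_{T⋆})`). The tree's Kato theorem
`kato_local_L3_holds` (`KatoLocalL3Exists.lean`; Kato 1984, Thm. 1) hands back a mild solution in
`C([0,T₀); L³)` with the weighted bound `√t ‖u(t)‖_∞ ≤ C`; this file re-runs its assembly from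
the Picard fixed point (`exists_kato_fixedPoint`, `continuousInLpOn_three_of_kato_fixedPoint`,
`KatoL3.isMildNSSolutionOn_of_fixedPoint`) keeping in addition the space–time integrability

  `u ∈ L⁵(0, T₀; L⁵)`   (`Fluid.MemLqLp 5 5 u (Ioo 0 T₀)`),

i.e. the `L₅(Q_T)` half of ESS (7.31) (Giga 1986: Kato's solution lies in `L^r(0,T; L^q)`,
`2/r + 3/q = 1`). Proof: from the fixed-point identity `u(t) = e^{tΔ}a - B(u,u)(t)`,
`‖u(t)‖₅ ≤ ‖e^{tΔ}a‖₅ + ‖B(u,u)(t)‖₅`; the free term is in `L⁵(0,∞)` by Giga's estimate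
(`HeatFlowGigaL5.lean`, via the maximal function); the Duhamel term obeys
`‖B(u,u)(t)‖₅ ≤ C ∫₀ᵗ (t-s)^{-3/4} ‖u(s)‖₆ ‖u(s)‖₅ ds` (Minkowski's integral inequality and the
`L^{30/11} → L⁵` bound of the Oseen kernel, tree `exists_eLpNorm_oseenSlice_le`), and Kato's class
gives `‖u(s)‖₆ ≤ 2δ₀ s^{-1/4}`, `‖u(s)‖₅ ≤ (L²N³)^{1/5} s^{-1/5}`; the `L⁵` absorption lemma
(`lintegral_rpow_five_le_of_volterra`, `VolterraQuarterKernel.lean`) then gives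
`∫₀^{T₀} ‖u‖₅⁵ ≤ 32 ∫₀^{T₀} ‖e^{tΔ}a‖₅⁵ < ∞` once `δ₀` is small. The general viscosity follows by
the scaling `u(t,x) = ν w(νt, x)` exactly as in `kato_local_L3_of_unit`.

## Main statements

* `exists_eLpNorm_five_oseenDuhamel_le` — `‖∫₀ᵗ∫K[u,v]‖₅ ≤ ∫₀ᵗ C (ν(t-τ))^{-3/4} ‖u(τ)‖₆ ‖v(τ)‖₅ dτ`;
* `kato_local_L3_L5_unit`, `kato_local_L3_L5` — Kato's weighted theorem (the statement of the
  tree's `kato_local_L3_unit` / `kato_local_L3`) with the extra clause `MemLqLp 5 5 u (Ioo 0 T₀)`;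
* `exists_isKatoSolutionOn_memLqLp_five` — for `ν > 0` and weakly divergence-free `u₀ ∈ L³(ℝ³)`
  there are `T > 0` and a Kato solution on `[0, T)` with `√t‖u(t)‖_∞ ≤ C` and `u ∈ L⁵(0,T; L⁵)`.

## Mathlib / tree search

Tree: `exists_kato_fixedPoint`, `measurable_uncurry_heatTest`, `eLpNorm_top_le_ofReal_of_norm_le`
(`KatoPicard`), `continuousInLpOn_three_of_kato_fixedPoint`, `measurable_uncurry_indicator_time`
(`KatoMildContinuity`), `KatoL3.isMildNSSolutionOn_of_fixedPoint`, `KatoL3.eKochTataruNorm_lt_top_of_kato_bounds`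
(`KatoL3FixedPointClass`), `exists_eLpNorm_oseenSlice_le`, `eLpNorm_norm_mul_norm_le` (`OseenKernelLp`),
`aestronglyMeasurable_oseenIntegrand_swap`, `measurable_slice` (`KatoBilinearEstimates`),
`FunctionSpaces.eLpNorm_integral_le_lintegral_eLpNorm` (Minkowski), `eLpNorm_five_pow_le`
(`LerayHopfProofs`), `exists_uniform_small_free_evolution` (`MildL3Smooth`), the scaling lemmas of
`KatoViscosityScaling` / `NSLerayHopfABCScaling` (`MemLqLp.viscosityRescale`),
`FunctionSpaces.measurable_eLpNorm_slice` (`TimeMollification`); no `L⁵_{t,x}` statement for Kato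
solutions existed (`lean search 'MemLqLp 5 5'`: only the ESS assembly files).

## References

* L. Escauriaza, G. Seregin, V. Šverák, Russ. Math. Surveys 58:2 (2003) 211–250, Appendix,
  Thm. 7.4 (7.31), proof (7.35)–(7.43). [EscauriazaSereginSverak2003]
* T. Kato, Math. Z. 187 (1984) 471–480, Thm. 1. [Kato1984]
* Y. Giga, J. Differential Equations 62 (1986) 186–212, Thm. 1 (solutions in `L^r(0,T;L^q)`). [Giga1986]
-/

noncomputable section

open MeasureTheory TopologicalSpace Set Function Filter Metric
open _root_.Topology
open scoped ENNReal NNReal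

namespace Literature.Analysis.FluidPDE

/-! ### The `L⁵` bound of the Oseen–Duhamel term -/

section Duhamel

variable {E : Type*} [NormedAddCommGroup E] [InnerProductSpace ℝ E] [FiniteDimensional ℝ E]
  [MeasurableSpace E] [BorelSpace E]

/-- The Hölder triple `(6, 5, 30/11)`: `6⁻¹ + 5⁻¹ = (30/11)⁻¹`. [folklore] -/
theorem holderTriple_six_five : ENNReal.HolderTriple 6 5 (30 / 11) := by
  refine ⟨?_⟩
  have h : ENNReal.ofReal 6⁻¹ + ENNReal.ofReal 5⁻¹ = ENNReal.ofReal (30 / 11)⁻¹ := by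
    rw [← ENNReal.ofReal_add (by positivity) (by positivity)]
    norm_num
  rw [ENNReal.ofReal_inv_of_pos (by norm_num), ENNReal.ofReal_inv_of_pos (by norm_num),
    ENNReal.ofReal_inv_of_pos (by norm_num), ENNReal.ofReal_div_of_pos (by norm_num),
    ENNReal.ofReal_ofNat, ENNReal.ofReal_ofNat] at h
  simpa only [ENNReal.ofReal_ofNat] using h

/-- **The `L⁵` estimate of the Oseen–Duhamel term** (the bilinear estimate behind ESS 2003,
Thm. 7.3 (7.20) in semigroup form; Giga 1986): in dimension three there is `C` with
`‖∫₀ᵗ ∫ K(ν(t-τ), ·-y)[u(τ,y), v(τ,y)] dy dτ‖_{L⁵} ≤ ∫₀ᵗ C (ν(t-τ))^{-3/4} ‖u(τ)‖₆ ‖v(τ)‖₅ dτ`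
for jointly measurable `u`, `v` (Minkowski's integral inequality, the `L^{30/11} → L⁵` bound of
the Oseen kernel `‖T_σ[a,b]‖₅ ≤ Cσ^{-3/4}‖|a||b|‖_{30/11}`, and Hölder `(6, 5, 30/11)`). [cite: EscauriazaSereginSverak2003, Thm. 7.3 (7.20)] -/
theorem exists_eLpNorm_five_oseenDuhamel_le (hE : Module.finrank ℝ E = 3) :
    ∃ C : ℝ, 0 ≤ C ∧ ∀ {ν : ℝ}, 0 < ν → ∀ {u v : ℝ → E → E}, Measurable (uncurry u) →
      Measurable (uncurry v) → ∀ {t : ℝ}, 0 < t →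
        eLpNorm (fun x => ∫ τ in Ioo 0 t, ∫ y, oseenKernel (ν * (t - τ)) (x - y) (u τ y) (v τ y))
            5 volume ≤
          ∫⁻ τ in Ioo 0 t, ENNReal.ofReal (C * (ν * (t - τ)) ^ (-(3 / 4 : ℝ))) *
            (eLpNorm (u τ) 6 volume * eLpNorm (v τ) 5 volume) := by
  obtain ⟨C, hC, hS⟩ := exists_eLpNorm_oseenSlice_le (E := E) (p := 30 / 11) (q := 5)
    (by
      rw [ENNReal.lt_div_iff_mul_lt (Or.inl (by norm_num)) (Or.inl (by norm_num))]
      norm_num)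
    (ENNReal.div_ne_top (by norm_num) (by norm_num))
    (by
      rw [ENNReal.div_le_iff (by norm_num) (by norm_num)]
      norm_num)
  haveI := holderTriple_six_five
  refine ⟨C, hC, fun {ν} hν {u v} hum hvm {t} ht => ?_⟩
  -- the exponent `-1/2 - (3/2)(11/30 - 1/5) = -3/4`
  have hexp : ∀ {σ : ℝ}, 0 < σ →
      σ ^ (-(1 / 2 : ℝ) - (Module.finrank ℝ E : ℝ) / 2 * (1 / (30 / 11 : ℝ≥0∞).toReal - 1 / (5 : ℝ≥0∞).toReal)) =
        σ ^ (-(3 / 4 : ℝ)) := by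
    intro σ _
    rw [hE, ENNReal.toReal_div, ENNReal.toReal_ofNat, ENNReal.toReal_ofNat, ENNReal.toReal_ofNat]
    norm_num
  set S : ℝ → E → E := fun τ x => ∫ y, oseenKernel (ν * (t - τ)) (x - y) (u τ y) (v τ y) with hSdef
  have hMink := FunctionSpaces.eLpNorm_integral_le_lintegral_eLpNorm (μ := (volume : Measure E))
    (ν := volume.restrict (Ioo 0 t)) (aestronglyMeasurable_oseenIntegrand_swap hum hvm ν t _)
    (p := 5) (by norm_num) (by norm_num)
  have hslice : ∀ τ ∈ Ioo 0 t, eLpNorm (S τ) 5 volume ≤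
      ENNReal.ofReal (C * (ν * (t - τ)) ^ (-(3 / 4 : ℝ))) * (eLpNorm (u τ) 6 volume * eLpNorm (v τ) 5 volume) := by
    intro τ hτ
    have hσ : 0 < ν * (t - τ) := mul_pos hν (sub_pos.2 hτ.2)
    have h1 := hS hσ (measurable_slice hum τ).aestronglyMeasurable (measurable_slice hvm τ).aestronglyMeasurable
    rw [hexp hσ] at h1
    refine h1.trans (mul_le_mul' le_rfl ?_)
    exact eLpNorm_norm_mul_norm_le (measurable_slice hum τ).aestronglyMeasurable
      (measurable_slice hvm τ).aestronglyMeasurable 6 5 (30 / 11)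
  calc eLpNorm (fun x => ∫ τ in Ioo 0 t, S τ x) 5 volume
      ≤ ∫⁻ τ in Ioo 0 t, eLpNorm (fun x => S τ x) 5 volume := hMink
    _ ≤ _ := setLIntegral_mono' measurableSet_Ioo fun τ hτ => hslice τ hτ

end Duhamel

/-! ### Kato's theorem at unit viscosity with the `L⁵` clause -/

section Unit


/-- From the mixed bounds `‖f‖_∞ ≤ L t^{-1/2}`, `‖f‖₃ ≤ N` to Kato's weighted `L⁵` bound
`‖f‖₅ ≤ (L² N³)^{1/5} t^{-1/5}` (`‖f‖₅⁵ ≤ ‖f‖_∞² ‖f‖₃³`, tree `eLpNorm_five_pow_le`). [folklore] -/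
theorem eLpNorm_five_le_weighted {f : (EuclideanSpace ℝ (Fin 3)) → (EuclideanSpace ℝ (Fin 3))} (hf : AEStronglyMeasurable f volume) {L N t : ℝ}
    (hL : 0 ≤ L) (hN : 0 ≤ N) (ht : 0 < t)
    (hinf : eLpNorm f ∞ volume ≤ ENNReal.ofReal (L * t ^ (-(1 / 2 : ℝ))))
    (h3 : eLpNorm f 3 volume ≤ ENNReal.ofReal N) :
    eLpNorm f 5 volume ≤ ENNReal.ofReal ((L ^ 2 * N ^ 3) ^ (1 / 5 : ℝ) * t ^ (-(1 / 5 : ℝ))) := by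
  have h5 := eLpNorm_five_pow_le (μ := (volume : Measure (EuclideanSpace ℝ (Fin 3)))) hf
  have hle : eLpNorm f 5 volume ^ 5 ≤ ENNReal.ofReal (L ^ 2 * N ^ 3 * t⁻¹) := by
    calc eLpNorm f 5 volume ^ 5 ≤ eLpNorm f ∞ volume ^ 2 * eLpNorm f 3 volume ^ 3 := h5
      _ ≤ ENNReal.ofReal (L * t ^ (-(1 / 2 : ℝ))) ^ 2 * ENNReal.ofReal N ^ 3 := by gcongr
      _ = ENNReal.ofReal (L ^ 2 * N ^ 3 * t⁻¹) := by
          rw [← ENNReal.ofReal_pow (by positivity), ← ENNReal.ofReal_pow hN, ← ENNReal.ofReal_mul (by positivity)]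
          congr 1
          rw [mul_pow, ← Real.rpow_natCast (t ^ (-(1 / 2 : ℝ))) 2, ← Real.rpow_mul ht.le,
            show (-(1 / 2 : ℝ)) * ((2 : ℕ) : ℝ) = -1 by norm_num, Real.rpow_neg_one]
          ring
  have hroot : eLpNorm f 5 volume ≤ (ENNReal.ofReal (L ^ 2 * N ^ 3 * t⁻¹)) ^ (5⁻¹ : ℝ) := by
    rw [ENNReal.le_rpow_inv_iff (by norm_num : (0 : ℝ) < 5)]
    exact_mod_cast (ENNReal.rpow_natCast _ 5).symm ▸ hle
  refine hroot.trans (le_of_eq ?_)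
  rw [ENNReal.ofReal_rpow_of_nonneg (by positivity) (by norm_num)]
  congr 1
  rw [Real.mul_rpow (by positivity) (inv_nonneg.2 ht.le)]
  congr 1
  · norm_num
  · rw [Real.inv_rpow ht.le, ← Real.rpow_neg ht.le]
    norm_num

/-- Slice measurability for a jointly measurable field: `t ↦ ‖u(t)‖_{L^r}` is measurable. [folklore] -/
theorem measurable_eLpNorm_slice_of_measurable {u : ℝ → (EuclideanSpace ℝ (Fin 3)) → (EuclideanSpace ℝ (Fin 3))} (hum : Measurable (uncurry u)) (r : ℝ≥0∞) :
    Measurable fun t => eLpNorm (u t) r volume :=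
  FunctionSpaces.measurable_eLpNorm_slice (μ := (volume : Measure (EuclideanSpace ℝ (Fin 3)))) hum.stronglyMeasurable r

/-- **Kato's weighted local existence theorem in `L³((EuclideanSpace ℝ (Fin 3)))` at unit viscosity, with the
`L⁵(0,T₀; L⁵)` clause** (Kato 1984, Thm. 1; ESS 2003, Thm. 7.4 (7.31); Giga 1986). There is an
absolute `δ₀ > 0` such that: if `u₀ ∈ L³` is weakly divergence free and the free evolution satisfies
`t^{1/4}‖e^{tΔ}u₀‖₆ ≤ δ₀` on `(0, T₀)`, then there is a mild solution `u` on `[0, T₀)` (duality form,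
unit viscosity, no force) in `C([0,T₀); L³)` with `u(0) = u₀`, measurable on `(0,T₀) × (EuclideanSpace ℝ (Fin 3))`, with
`‖u(t)‖_∞ ≤ C/√t`, **and `u ∈ L⁵(0, T₀; L⁵((EuclideanSpace ℝ (Fin 3))))`**. The first five clauses are the tree's
`kato_local_L3_unit` (proof copied from `kato_local_L3_unit_holds`); the last is new (Giga's
estimate for the free term, the `L⁵` Duhamel bound in Kato's class, and the `L⁵` absorption
lemma). [cite: EscauriazaSereginSverak2003, Thm. 7.4 (7.31)] -/
theorem kato_local_L3_L5_unit :
    ∃ δ₀ : ℝ, 0 < δ₀ ∧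
      ∀ {T₀ : ℝ} (_hT₀ : 0 < T₀) {u₀ : (EuclideanSpace ℝ (Fin 3)) → (EuclideanSpace ℝ (Fin 3))}
        (_hu₀ : MemLp u₀ 3 volume) (_hdiv : IsWeaklyDivFree u₀)
        (_hsmall : ∀ t ∈ Ioo 0 T₀, ENNReal.ofReal (t ^ (1 / 4 : ℝ)) *
            eLpNorm (UnboundedOperators.heatExtension u₀ t) 6 volume ≤ ENNReal.ofReal δ₀),
        ∃ u : ℝ → (EuclideanSpace ℝ (Fin 3)) → (EuclideanSpace ℝ (Fin 3)),
          IsMildNSSolutionOn (Ico 0 T₀) 1 0 u₀ u ∧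
            ContinuousInLpOn (Ico 0 T₀) 3 u ∧ u 0 = u₀ ∧
            AEStronglyMeasurable (uncurry u) (volume.restrict (Ioo 0 T₀ ×ˢ univ)) ∧
            (∃ C : ℝ, ∀ t ∈ Ioo 0 T₀, eLpNorm (u t) ∞ volume ≤ ENNReal.ofReal (C / Real.sqrt t)) ∧
            MemLqLp 5 5 u (Ioo 0 T₀) := by
  have hE3 : Module.finrank ℝ (EuclideanSpace ℝ (Fin 3)) = 3 := finrank_euclideanSpace_fin
  obtain ⟨c, hc, hFP⟩ := exists_kato_fixedPoint (E := (EuclideanSpace ℝ (Fin 3))) hE3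
  obtain ⟨C₅, hC₅, hB5⟩ := exists_eLpNorm_five_oseenDuhamel_le (E := (EuclideanSpace ℝ (Fin 3))) hE3
  obtain ⟨Λ₀, hΛ₀, hVolt⟩ := lintegral_rpow_five_le_of_volterra
  -- a real number `lam₀ > 0` with `ofReal lam₀ ≤ Λ₀`
  set lam₀ : ℝ := if Λ₀ = ⊤ then 1 else Λ₀.toReal with hlam₀
  have hlam₀pos : 0 < lam₀ := by
    rw [hlam₀]; split_ifs with h
    · exact one_pos
    · exact ENNReal.toReal_pos hΛ₀.ne' h
  have hlam₀le : ENNReal.ofReal lam₀ ≤ Λ₀ := by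
    rw [hlam₀]; split_ifs with h
    · rw [h]; exact le_top
    · rw [ENNReal.ofReal_toReal h]
  -- the smallness constant: Kato's `1/c` and the absorption threshold
  set δ₀ : ℝ := min (1 / c) (lam₀ / (2 * C₅ + 2)) with hδ₀def
  have hδ₀pos : 0 < δ₀ := lt_min (by positivity) (by positivity)
  have hδ₀c : δ₀ ≤ 1 / c := min_le_left _ _
  have hΛsmall : ENNReal.ofReal (C₅ * (2 * δ₀)) ≤ Λ₀ := by
    refine le_trans (ENNReal.ofReal_le_ofReal ?_) hlam₀le
    have h1 : δ₀ ≤ lam₀ / (2 * C₅ + 2) := min_le_right _ _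
    have h2 : C₅ * (2 * δ₀) ≤ C₅ * (2 * (lam₀ / (2 * C₅ + 2))) := by gcongr
    refine h2.trans ?_
    rw [show C₅ * (2 * (lam₀ / (2 * C₅ + 2))) = lam₀ * (2 * C₅ / (2 * C₅ + 2)) by ring]
    have h3 : 2 * C₅ / (2 * C₅ + 2) ≤ 1 := by
      rw [div_le_one (by positivity)]; linarith
    calc lam₀ * (2 * C₅ / (2 * C₅ + 2)) ≤ lam₀ * 1 := mul_le_mul_of_nonneg_left h3 hlam₀pos.le
      _ = lam₀ := mul_one _
  refine ⟨δ₀, hδ₀pos, fun {T₀} hT₀ {u₀} hu₀ hdiv hsmall => ?_⟩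
  have hδ : c * δ₀ * (1 : ℝ) ^ (-(3 / 4 : ℝ)) ≤ 1 := by
    rw [Real.one_rpow, mul_one]
    calc c * δ₀ ≤ c * (1 / c) := mul_le_mul_of_nonneg_left hδ₀c hc.le
      _ = 1 := mul_one_div_cancel hc.ne'
  -- a strongly measurable representative of the datum
  set v₀ : (EuclideanSpace ℝ (Fin 3)) → (EuclideanSpace ℝ (Fin 3)) := hu₀.1.mk u₀ with hv₀
  have hv₀m : StronglyMeasurable v₀ := hu₀.1.stronglyMeasurable_mk
  have hae : u₀ =ᵐ[volume] v₀ := hu₀.1.ae_eq_mk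
  have hv₀ : MemLp v₀ 3 volume := hu₀.ae_eq hae
  have hheat : ∀ {t : ℝ}, 0 < t → heatTest 1 v₀ t = UnboundedOperators.heatExtension u₀ t := by
    intro t ht
    rw [heatTest_of_pos one_pos ht, one_mul, heatExtension_congr_ae hae]
  -- the smallness hypothesis in the form of the fixed-point theorem
  have hsm : ∀ t ∈ Ioo 0 T₀,
      eLpNorm (heatTest 1 v₀ t) 6 volume ≤ ENNReal.ofReal (δ₀ * t ^ (-(1 / 4 : ℝ))) := by
    intro t ht
    rw [hheat ht.1]
    exact le_ofReal_mul_rpow_neg_of_weighted_le ht.1 (hsmall t ht)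
  -- the fixed point
  obtain ⟨u, hum, hu0, hfix, h6, hinf, h6loc⟩ := hFP one_pos hv₀m hv₀ hT₀ hδ₀pos hδ hsm
  set L : ℝ := 2 * (δ₀ + (4 * Real.pi * 1) ^ (-(1 / 2 : ℝ)) * (eLpNorm v₀ 3 volume).toReal)
    with hL
  have hL0 : 0 ≤ L := by positivity
  -- localised smallness of the solution at `t → 0`
  have hsmall' : ∀ η : ℝ, 0 < η → ∃ t₁ : ℝ, 0 < t₁ ∧ ∀ t ∈ Ioo 0 t₁, t < T₀ →
      eLpNorm (u t) 6 volume ≤ ENNReal.ofReal (η * t ^ (-(1 / 4 : ℝ))) := by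
    intro η hη
    set α₁ : ℝ := min (η / 2) δ₀ with hα₁
    have hα₁0 : 0 < α₁ := lt_min (by positivity) hδ₀pos
    have hα₁c : c * α₁ * (1 : ℝ) ^ (-(3 / 4 : ℝ)) ≤ 1 := by
      rw [Real.one_rpow, mul_one]
      calc c * α₁ ≤ c * δ₀ := mul_le_mul_of_nonneg_left (min_le_right _ _) hc.le
        _ ≤ c * (1 / c) := mul_le_mul_of_nonneg_left hδ₀c hc.le
        _ = 1 := mul_one_div_cancel hc.ne'
    have hvc : ContinuousInLpOn ({0} : Set ℝ) 3 (fun _ : ℝ => v₀) :=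
      ⟨fun _ _ => hv₀, fun t₀ _ => by
        simp only [sub_self, eLpNorm_zero]
        exact tendsto_const_nhds⟩
    obtain ⟨T₁, hT₁, hsmT₁⟩ := exists_uniform_small_free_evolution one_pos isCompact_singleton
      (subset_refl _) hvc hα₁0
    refine ⟨min T₁ T₀, lt_min hT₁ hT₀, fun t ht _ => ?_⟩
    have hloc : ∀ s ∈ Ioo 0 (min T₁ T₀),
        eLpNorm (heatTest 1 v₀ s) 6 volume ≤ ENNReal.ofReal (α₁ * s ^ (-(1 / 4 : ℝ))) := by
      intro s hs
      have h := hsmT₁ 0 (mem_singleton 0) s ⟨hs.1, hs.2.trans_le (min_le_left _ _)⟩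
      rw [heatTest_of_pos one_pos hs.1]
      exact le_ofReal_mul_rpow_neg_of_weighted_le hs.1 h
    have h := h6loc (min_le_right _ _) hα₁0 hα₁c hloc t ht
    refine h.trans (ENNReal.ofReal_le_ofReal (mul_le_mul_of_nonneg_right ?_
      (Real.rpow_nonneg ht.1.le _)))
    have : α₁ ≤ η / 2 := min_le_left _ _
    linarith
  -- `u ∈ C([0,T₀); L³)` and the `L³` bound
  obtain ⟨hcont, N, hN0, hu3⟩ := continuousInLpOn_three_of_kato_fixedPoint hE3 one_pos hv₀ hum
    (K := 2 * δ₀) (L := L) (by positivity) hL0 hu0 hfix h6 hinf hsmall'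
  -- ### the new clause: `∫₀^{T₀} ‖u(t)‖₅⁵ dt < ∞`
  have hslice_m : ∀ t, Measurable (u t) := fun t => hum.comp (measurable_const.prodMk measurable_id)
  have hφm : Measurable fun t => eLpNorm (u t) 5 volume := measurable_eLpNorm_slice_of_measurable hum 5
  have hUm : Measurable (uncurry (heatTest 1 v₀)) := measurable_uncurry_heatTest hv₀m 1
  have hψm : Measurable fun t => eLpNorm (heatTest 1 v₀ t) 5 volume :=
    measurable_eLpNorm_slice_of_measurable hUm 5
  set M : ℝ := (L ^ 2 * N ^ 3) ^ (1 / 5 : ℝ) with hM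
  have hM0 : 0 ≤ M := by positivity
  have hφM : ∀ t ∈ Ioo 0 T₀, eLpNorm (u t) 5 volume ≤ ENNReal.ofReal (M * t ^ (-(1 / 5 : ℝ))) := by
    intro t ht
    refine eLpNorm_five_le_weighted (hslice_m t).aestronglyMeasurable hL0 hN0 ht.1 ?_ (hu3 t ht)
    exact eLpNorm_top_le_ofReal_of_norm_le (hinf t ht)
  -- the Volterra inequality for `φ(t) = ‖u(t)‖₅`
  have hineq : ∀ t ∈ Ioo 0 T₀, eLpNorm (u t) 5 volume ≤ eLpNorm (heatTest 1 v₀ t) 5 volume +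
      ENNReal.ofReal (C₅ * (2 * δ₀)) * ∫⁻ s in Ioo 0 t,
        ENNReal.ofReal ((t - s) ^ (-(3 / 4 : ℝ)) * s ^ (-(1 / 4 : ℝ))) * eLpNorm (u s) 5 volume := by
    intro t ht
    set B : (EuclideanSpace ℝ (Fin 3)) → (EuclideanSpace ℝ (Fin 3)) := fun x => ∫ τ in Ioo 0 t, ∫ y, oseenKernel (1 * (t - τ)) (x - y) (u τ y) (u τ y)
      with hBdef
    have hut : u t = heatTest 1 v₀ t - B := by
      funext x; simp only [Pi.sub_apply, hBdef]; exact hfix t ht x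
    have hBm : AEStronglyMeasurable B volume := by
      have : B = heatTest 1 v₀ t - u t := by rw [hut]; abel
      rw [this]
      exact (measurable_slice hUm t).aestronglyMeasurable.sub (hslice_m t).aestronglyMeasurable
    have hB := hB5 one_pos hum hum ht.1
    have hpt : ∀ τ ∈ Ioo 0 t, ENNReal.ofReal (C₅ * (1 * (t - τ)) ^ (-(3 / 4 : ℝ))) *
        (eLpNorm (u τ) 6 volume * eLpNorm (u τ) 5 volume) ≤
        ENNReal.ofReal (C₅ * (2 * δ₀)) *
          (ENNReal.ofReal ((t - τ) ^ (-(3 / 4 : ℝ)) * τ ^ (-(1 / 4 : ℝ))) * eLpNorm (u τ) 5 volume) := by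
      intro τ hτ
      have hτT : τ ∈ Ioo 0 T₀ := ⟨hτ.1, hτ.2.trans ht.2⟩
      have htτ : 0 ≤ (t - τ) ^ (-(3 / 4 : ℝ)) := Real.rpow_nonneg (sub_nonneg.2 hτ.2.le) _
      calc ENNReal.ofReal (C₅ * (1 * (t - τ)) ^ (-(3 / 4 : ℝ))) * (eLpNorm (u τ) 6 volume * eLpNorm (u τ) 5 volume)
          ≤ ENNReal.ofReal (C₅ * (1 * (t - τ)) ^ (-(3 / 4 : ℝ))) *
              (ENNReal.ofReal (2 * δ₀ * τ ^ (-(1 / 4 : ℝ))) * eLpNorm (u τ) 5 volume) := by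
            gcongr
            exact h6 τ hτT
        _ = ENNReal.ofReal (C₅ * (2 * δ₀)) *
              (ENNReal.ofReal ((t - τ) ^ (-(3 / 4 : ℝ)) * τ ^ (-(1 / 4 : ℝ))) * eLpNorm (u τ) 5 volume) := by
            rw [one_mul, ← mul_assoc, ← mul_assoc, ← ENNReal.ofReal_mul (by positivity),
              ← ENNReal.ofReal_mul (by positivity)]
            congr 2
            ring
    calc eLpNorm (u t) 5 volume = eLpNorm (heatTest 1 v₀ t - B) 5 volume := by rw [hut]
      _ ≤ eLpNorm (heatTest 1 v₀ t) 5 volume + eLpNorm B 5 volume :=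
          eLpNorm_sub_le (measurable_slice hUm t).aestronglyMeasurable hBm (by norm_num)
      _ ≤ eLpNorm (heatTest 1 v₀ t) 5 volume + ∫⁻ τ in Ioo 0 t, ENNReal.ofReal (C₅ * (1 * (t - τ)) ^ (-(3 / 4 : ℝ))) *
            (eLpNorm (u τ) 6 volume * eLpNorm (u τ) 5 volume) := add_le_add le_rfl hB
      _ ≤ eLpNorm (heatTest 1 v₀ t) 5 volume + ∫⁻ τ in Ioo 0 t, ENNReal.ofReal (C₅ * (2 * δ₀)) *
            (ENNReal.ofReal ((t - τ) ^ (-(3 / 4 : ℝ)) * τ ^ (-(1 / 4 : ℝ))) * eLpNorm (u τ) 5 volume) :=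
          add_le_add le_rfl (setLIntegral_mono' measurableSet_Ioo hpt)
      _ = _ := by rw [lintegral_const_mul' _ _ ENNReal.ofReal_ne_top]
  -- the absorption lemma: `∫₀^{T₀} ‖u‖₅⁵ ≤ 32 ∫₀^{T₀} ‖e^{tΔ}u₀‖₅⁵ < ∞`
  have hVolt' := hVolt hφm hψm hM0 hφM hΛsmall hineq
  have hψ5 : ∫⁻ t in Ioo 0 T₀, eLpNorm (heatTest 1 v₀ t) 5 volume ^ (5 : ℝ) < ⊤ := by
    have hG := lintegral_Ioi_eLpNorm_heatExtension_pow_five_lt_top (E := (EuclideanSpace ℝ (Fin 3))) (F := (EuclideanSpace ℝ (Fin 3))) hE3 hv₀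
    refine lt_of_le_of_lt ?_ hG
    calc ∫⁻ t in Ioo 0 T₀, eLpNorm (heatTest 1 v₀ t) 5 volume ^ (5 : ℝ)
        = ∫⁻ t in Ioo 0 T₀, eLpNorm (UnboundedOperators.heatExtension v₀ t) 5 volume ^ 5 := by
          refine setLIntegral_congr_fun measurableSet_Ioo fun t ht => ?_
          rw [heatTest_of_pos one_pos ht.1, one_mul, ← ENNReal.rpow_natCast]
          norm_num
      _ ≤ ∫⁻ t in Ioi 0, eLpNorm (UnboundedOperators.heatExtension v₀ t) 5 volume ^ 5 :=
          lintegral_mono_set fun t ht => ht.1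
  have hφ5 : ∫⁻ t in Ioo 0 T₀, eLpNorm (u t) 5 volume ^ (5 : ℝ) < ⊤ :=
    lt_of_le_of_lt hVolt' (ENNReal.mul_lt_top (by norm_num) hψ5)
  -- ### the field handed back (as in `kato_local_L3_unit_holds`)
  set w : ℝ → (EuclideanSpace ℝ (Fin 3)) → (EuclideanSpace ℝ (Fin 3)) := fun t => if t = 0 then u₀ else (Ioo 0 T₀).indicator u t with hw
  have hw0 : w 0 = u₀ := by simp only [hw, if_pos rfl]
  have hwt : ∀ t ∈ Ioo 0 T₀, w t = u t := fun t ht => by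
    simp only [hw, if_neg ht.1.ne', Set.indicator_of_mem ht]
  have hwz : ∀ t, t ∉ Ioo 0 T₀ → t ≠ 0 → w t = 0 := fun t ht ht0 => by
    simp only [hw, if_neg ht0, Set.indicator_of_notMem ht]
  -- measurability on `(0, ∞) × (EuclideanSpace ℝ (Fin 3))`
  have hvm : Measurable (uncurry ((Ioo 0 T₀).indicator u)) :=
    measurable_uncurry_indicator_time hum measurableSet_Ioo
  have hwae : ∀ {S : Set ℝ}, MeasurableSet S → (0 : ℝ) ∉ S →
      AEStronglyMeasurable (uncurry w) ((volume : Measure (ℝ × (EuclideanSpace ℝ (Fin 3)))).restrict (S ×ˢ univ)) := by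
    intro S hS h0
    refine hvm.aestronglyMeasurable.congr ?_
    filter_upwards [ae_restrict_mem (hS.prod MeasurableSet.univ)] with q hq
    have hq0 : q.1 ≠ 0 := fun h => h0 (h ▸ (mem_prod.1 hq).1)
    simp only [uncurry, hw, if_neg hq0]
  have hwIoi : AEStronglyMeasurable (uncurry w)
      ((volume : Measure (ℝ × (EuclideanSpace ℝ (Fin 3)))).restrict (Ioi 0 ×ˢ univ)) :=
    hwae measurableSet_Ioi (fun h => lt_irrefl (0 : ℝ) h)
  have hwIoo : AEStronglyMeasurable (uncurry w)
      ((volume : Measure (ℝ × (EuclideanSpace ℝ (Fin 3)))).restrict (Ioo 0 T₀ ×ˢ univ)) :=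
    hwae measurableSet_Ioo (fun h => lt_irrefl (0 : ℝ) h.1)
  have hwsl : ∀ t, AEStronglyMeasurable (w t) volume := by
    intro t
    by_cases ht0 : t = 0
    · rw [ht0, hw0]; exact hu₀.1
    by_cases ht : t ∈ Ioo 0 T₀
    · rw [hwt t ht]; exact (hslice_m t).aestronglyMeasurable
    · rw [hwz t ht ht0]; exact aestronglyMeasurable_zero
  -- Kato's bounds for all `t > 0`
  have hwinf : ∀ t, 0 < t → eLpNorm (w t) ∞ volume ≤ ENNReal.ofReal (L * t ^ (-(1 / 2 : ℝ))) := by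
    intro t ht
    by_cases htT : t < T₀
    · rw [hwt t ⟨ht, htT⟩]
      exact eLpNorm_top_le_ofReal_of_norm_le (hinf t ⟨ht, htT⟩)
    · rw [hwz t (fun h => htT h.2) ht.ne', eLpNorm_zero]
      exact bot_le
  have hw3 : ∀ t, 0 < t → eLpNorm (w t) 3 volume ≤ ENNReal.ofReal N := by
    intro t ht
    by_cases htT : t < T₀
    · rw [hwt t ⟨ht, htT⟩]; exact hu3 t ⟨ht, htT⟩
    · rw [hwz t (fun h => htT h.2) ht.ne', eLpNorm_zero]
      exact bot_le
  have hX : eKochTataruNorm w < ∞ := KatoL3.eKochTataruNorm_lt_top_of_kato_bounds hE3 hwsl hwinf hw3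
  have hw3mem : ∀ t ∈ Ioo 0 T₀, MemLp (w t) 3 volume := fun t ht => by
    rw [hwt t ht]; exact hcont.1 t ⟨ht.1.le, ht.2⟩
  -- the fixed-point identity in the tree's form
  have hfixae : ∀ t ∈ Ioo 0 T₀, w t =ᵐ[volume]
      fun x => UnboundedOperators.heatExtension u₀ t x - kochTataruBilinear w w t x := by
    intro t ht
    refine Eventually.of_forall fun x => ?_
    rw [hwt t ht, hfix t ht x, hheat ht.1]
    congr 1
    simp only [kochTataruBilinear, one_mul]
    refine setIntegral_congr_fun measurableSet_Ioo fun s hs => ?_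
    simp only [hwt s ⟨hs.1, hs.2.trans ht.2⟩]
  have hmild : IsMildNSSolutionOn (Ico 0 T₀) 1 0 u₀ w :=
    KatoL3.isMildNSSolutionOn_of_fixedPoint hu₀ hdiv hw0 hwIoi hX hw3mem hfixae
  -- continuity in `L³` on `[0, T₀)`
  have hwcont : ContinuousInLpOn (Ico 0 T₀) 3 w := by
    refine hcont.congr_ae_slices fun t ht => ?_
    rcases ht.1.eq_or_lt with h | h
    · rw [← h, hw0, hu0]
      exact hae
    · rw [hwt t ⟨h, ht.2⟩]
  -- ### the `L⁵(0,T₀; L⁵)` clause for `w`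
  have hw5 : MemLqLp 5 5 w (Ioo 0 T₀) := by
    have hmem : ∀ t ∈ Ioo 0 T₀, MemLp (w t) 5 volume := by
      intro t ht
      rw [hwt t ht]
      exact ⟨(hslice_m t).aestronglyMeasurable, (hφM t ht).trans_lt ENNReal.ofReal_lt_top⟩
    refine ⟨(ae_restrict_iff' measurableSet_Ioo).2 (Eventually.of_forall hmem), ?_⟩
    rw [eLqLpNorm, eLpNorm_lt_top_iff_lintegral_rpow_enorm_lt_top (by norm_num) (by norm_num)]
    simp only [ENNReal.toReal_ofNat]
    refine lt_of_le_of_lt (setLIntegral_mono' measurableSet_Ioo fun t ht => ?_) hφ5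
    rw [hwt t ht, Real.enorm_eq_ofReal ENNReal.toReal_nonneg]
    exact ENNReal.rpow_le_rpow ENNReal.ofReal_toReal_le (by norm_num)
  refine ⟨w, hmild, hwcont, hw0, hwIoo, ⟨L, fun t ht => ?_⟩, hw5⟩
  refine (hwinf t ht.1).trans (le_of_eq ?_)
  rw [Real.sqrt_eq_rpow, Real.rpow_neg ht.1.le, div_eq_mul_inv L]

/-- **Kato's weighted local existence theorem in `L³((EuclideanSpace ℝ (Fin 3)))` with the `L⁵(0,T₀; L⁵)` clause, every
viscosity `ν > 0`** (the statement of the tree's `kato_local_L3` plus `MemLqLp 5 5 u (Ioo 0 T₀)`):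
from the unit-viscosity form by the scaling `u(t, x) = ν w(νt, x)` — proof copied from
`kato_local_L3_of_unit`, the new clause being transported by `MemLqLp.viscosityRescale`
(Kato 1984, §1: "we may assume `ν = 1`"; ESS 2003, Thm. 7.4 (7.31)). [cite: EscauriazaSereginSverak2003, Thm. 7.4 (7.31)] -/
theorem kato_local_L3_L5 :
    ∃ δ₀ : ℝ, 0 < δ₀ ∧
      ∀ {ν T₀ : ℝ} (_hν : 0 < ν) (_hT₀ : 0 < T₀) {u₀ : (EuclideanSpace ℝ (Fin 3)) → (EuclideanSpace ℝ (Fin 3))}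
        (_hu₀ : MemLp u₀ 3 volume) (_hdiv : IsWeaklyDivFree u₀)
        (_hsmall : ∀ t ∈ Ioo 0 T₀, ENNReal.ofReal (t ^ (1 / 4 : ℝ)) *
            eLpNorm (UnboundedOperators.heatExtension u₀ (ν * t)) 6 volume ≤
          ENNReal.ofReal (δ₀ * ν ^ (3 / 4 : ℝ))),
        ∃ u : ℝ → (EuclideanSpace ℝ (Fin 3)) → (EuclideanSpace ℝ (Fin 3)),
          IsMildNSSolutionOn (Ico 0 T₀) ν 0 u₀ u ∧
            ContinuousInLpOn (Ico 0 T₀) 3 u ∧ u 0 = u₀ ∧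
            AEStronglyMeasurable (uncurry u) (volume.restrict (Ioo 0 T₀ ×ˢ univ)) ∧
            (∃ C : ℝ, ∀ t ∈ Ioo 0 T₀, eLpNorm (u t) ∞ volume ≤ ENNReal.ofReal (C / Real.sqrt t)) ∧
            MemLqLp 5 5 u (Ioo 0 T₀) := by
  obtain ⟨δ₀, hδ₀, h⟩ := kato_local_L3_L5_unit
  refine ⟨δ₀, hδ₀, fun {ν T₀} hν hT₀ {u₀} hu₀ hdiv hsmall => ?_⟩
  have hν0 : ν ≠ 0 := hν.ne'
  -- unit-viscosity data `w₀ = ν⁻¹ u₀` on the window `(0, ν T₀)`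
  set w₀ : (EuclideanSpace ℝ (Fin 3)) → (EuclideanSpace ℝ (Fin 3)) := ν⁻¹ • u₀ with hw₀_def
  have hS₀ : 0 < ν * T₀ := mul_pos hν hT₀
  have hw₀ : MemLp w₀ 3 volume := hu₀.const_smul ν⁻¹
  have hw₀div : IsWeaklyDivFree w₀ := hdiv.const_smul ν⁻¹
  have hw₀small : ∀ s ∈ Ioo 0 (ν * T₀), ENNReal.ofReal (s ^ (1 / 4 : ℝ)) *
      eLpNorm (UnboundedOperators.heatExtension w₀ s) 6 volume ≤ ENNReal.ofReal δ₀ := by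
    intro s hs
    set t : ℝ := ν⁻¹ * s with ht_def
    have hst : s = ν * t := by rw [ht_def, ← mul_assoc, mul_inv_cancel₀ hν0, one_mul]
    have ht : t ∈ Ioo 0 T₀ := by
      refine ⟨by rw [ht_def]; exact mul_pos (inv_pos.2 hν) hs.1, ?_⟩
      have h2 := hs.2
      rw [hst] at h2
      exact lt_of_mul_lt_mul_left h2 hν.le
    have hlin : UnboundedOperators.heatExtension w₀ s =
        ν⁻¹ • UnboundedOperators.heatExtension u₀ (ν * t) := by
      funext x
      rw [hst]
      exact UnboundedOperators.heatExtension_const_smul ν⁻¹ u₀ (ν * t) x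
    rw [hlin, eLpNorm_const_smul, hst]
    have hkey := hsmall t ht
    have hpow : (ν * t) ^ (1 / 4 : ℝ) * ν⁻¹ = ν ^ (-(3 / 4 : ℝ)) * t ^ (1 / 4 : ℝ) := by
      rw [Real.mul_rpow hν.le ht.1.le]
      have h1 : ν ^ (1 / 4 : ℝ) * ν⁻¹ = ν ^ (-(3 / 4 : ℝ)) := by
        rw [← Real.rpow_neg_one, ← Real.rpow_add hν]
        norm_num
      calc ν ^ (1 / 4 : ℝ) * t ^ (1 / 4 : ℝ) * ν⁻¹ = ν ^ (1 / 4 : ℝ) * ν⁻¹ * t ^ (1 / 4 : ℝ) := by ring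
        _ = ν ^ (-(3 / 4 : ℝ)) * t ^ (1 / 4 : ℝ) := by rw [h1]
    have hνinv : ‖ν⁻¹‖ₑ = ENNReal.ofReal ν⁻¹ := Real.enorm_eq_ofReal (inv_nonneg.2 hν.le)
    calc ENNReal.ofReal ((ν * t) ^ (1 / 4 : ℝ)) *
          (‖ν⁻¹‖ₑ * eLpNorm (UnboundedOperators.heatExtension u₀ (ν * t)) 6 volume)
        = ENNReal.ofReal (ν ^ (-(3 / 4 : ℝ))) * (ENNReal.ofReal (t ^ (1 / 4 : ℝ)) *
            eLpNorm (UnboundedOperators.heatExtension u₀ (ν * t)) 6 volume) := by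
          rw [hνinv, ← mul_assoc, ← ENNReal.ofReal_mul (Real.rpow_nonneg (mul_nonneg hν.le ht.1.le) _),
            hpow, ENNReal.ofReal_mul (Real.rpow_nonneg hν.le _), mul_assoc]
      _ ≤ ENNReal.ofReal (ν ^ (-(3 / 4 : ℝ))) * ENNReal.ofReal (δ₀ * ν ^ (3 / 4 : ℝ)) :=
          mul_le_mul' le_rfl hkey
      _ = ENNReal.ofReal δ₀ := by
          rw [← ENNReal.ofReal_mul (Real.rpow_nonneg hν.le _)]
          congr 1
          rw [mul_comm δ₀, ← mul_assoc, ← Real.rpow_add hν]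
          norm_num
  -- the unit solution and its rescaling
  obtain ⟨w, hw, hwc, hw0, hwm, ⟨C, hC⟩, hw5⟩ := h hS₀ hw₀ hw₀div hw₀small
  set u : ℝ → (EuclideanSpace ℝ (Fin 3)) → (EuclideanSpace ℝ (Fin 3)) := timeRescale ν ν w with hu_def
  have hmaps : MapsTo (fun t => ν * t) (Ico 0 T₀) (Ico 0 (ν * T₀)) := fun t ht =>
    ⟨mul_nonneg hν.le ht.1, mul_lt_mul_of_pos_left ht.2 hν⟩
  have hνw₀ : ν • w₀ = u₀ := by
    rw [hw₀_def, smul_smul, mul_inv_cancel₀ hν0, one_smul]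
  refine ⟨u, ?_, hwc.timeRescale ν hmaps, ?_, ?_, ⟨C * Real.sqrt ν, fun t ht => ?_⟩, ?_⟩
  · -- mild solution with viscosity `ν · 1 = ν`, datum `ν • w₀ = u₀`, force `0`
    have h1 := hw.timeRescale hν hmaps
    have hf : timeRescale ν (ν ^ 2) (0 : ℝ → (EuclideanSpace ℝ (Fin 3)) → (EuclideanSpace ℝ (Fin 3))) = 0 := by
      funext s x
      simp [timeRescale_apply]
    rw [hf, hνw₀, mul_one] at h1
    exact h1
  · -- `u 0 = u₀`
    funext x
    simp only [hu_def, timeRescale_apply, mul_zero, hw0]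
    rw [← hνw₀]
    rfl
  · -- measurability on `(0, T₀) × (EuclideanSpace ℝ (Fin 3))`
    exact aestronglyMeasurable_uncurry_timeRescale_Ioo hν hwm ν
  · -- the weighted `L^∞` bound, constant `C √ν`
    have hνt : ν * t ∈ Ioo 0 (ν * T₀) := ⟨mul_pos hν ht.1, mul_lt_mul_of_pos_left ht.2 hν⟩
    have hut : u t = ν • w (ν * t) := by
      funext x
      simp [hu_def, timeRescale_apply]
    rw [hut, eLpNorm_const_smul, Real.enorm_eq_ofReal hν.le]
    calc ENNReal.ofReal ν * eLpNorm (w (ν * t)) ∞ volume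
        ≤ ENNReal.ofReal ν * ENNReal.ofReal (C / Real.sqrt (ν * t)) := mul_le_mul' le_rfl (hC _ hνt)
      _ = ENNReal.ofReal (C * Real.sqrt ν / Real.sqrt t) := by
          rw [← ENNReal.ofReal_mul hν.le]
          congr 1
          have hsν : 0 < Real.sqrt ν := Real.sqrt_pos.2 hν
          have hst : 0 < Real.sqrt t := Real.sqrt_pos.2 ht.1
          rw [Real.sqrt_mul hν.le]
          field_simp
          rw [Real.sq_sqrt hν.le]
          ring
  · -- the `L⁵(0,T₀; L⁵)` clause: scaling covariance of the mixed class
    have h5 := hw5.viscosityRescale hν ν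
    rwa [mul_div_cancel_left₀ T₀ hν0] at h5

/-- **A Kato solution with `√t‖u(t)‖_∞ ≤ C` and `u ∈ L⁵(0,T; L⁵)` exists for every weakly
divergence-free `u₀ ∈ L³((EuclideanSpace ℝ (Fin 3)))` and `ν > 0`** (Kato 1984, Thm. 1; ESS 2003, Thm. 7.4 (7.31);
Giga 1986): the free evolution is small in Kato's weighted class on some window `(0, T)`
(`exists_uniform_small_free_evolution`, the classical `t^{1/4}‖e^{νtΔ}u₀‖₆ → 0`), on which
`kato_local_L3_L5` applies. [cite: EscauriazaSereginSverak2003, Thm. 7.4 (7.31)] -/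
theorem exists_isKatoSolutionOn_memLqLp_five {ν : ℝ} (hν : 0 < ν) {u₀ : (EuclideanSpace ℝ (Fin 3)) → (EuclideanSpace ℝ (Fin 3))}
    (hu₀ : MemLp u₀ 3 volume) (hdiv : IsWeaklyDivFree u₀) :
    ∃ T : ℝ, 0 < T ∧ ∃ u : ℝ → (EuclideanSpace ℝ (Fin 3)) → (EuclideanSpace ℝ (Fin 3)), IsKatoSolutionOn T ν u₀ u ∧
      (∃ C : ℝ, ∀ t ∈ Ioo 0 T, eLpNorm (u t) ∞ volume ≤ ENNReal.ofReal (C / Real.sqrt t)) ∧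
      MemLqLp 5 5 u (Ioo 0 T) := by
  obtain ⟨δ₀, hδ₀, hK⟩ := kato_local_L3_L5
  have hη : 0 < δ₀ * ν ^ (3 / 4 : ℝ) := by positivity
  obtain ⟨T₀, hT₀, hsmall⟩ := exists_uniform_small_free_evolution hν
    (isCompact_singleton (x := (0 : ℝ))) (singleton_subset_iff.2 (mem_singleton (0 : ℝ)))
    (continuousInLpOn_const_of_memLp hu₀ {(0 : ℝ)}) hη
  obtain ⟨u, hu, huc, hu0, hum, hC, h5⟩ :=
    hK hν hT₀ hu₀ hdiv fun t ht => hsmall 0 (mem_singleton (0 : ℝ)) t ht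
  exact ⟨T₀, hT₀, u, ⟨hu, huc, hu0, hum⟩, hC, h5⟩

end Unit

end Literature.Analysis.FluidPDE
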